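/-
Copyright (c) 2026 the pub-hodgecm-mathlib formalisation cell (harness21).  Prover seat hodgecm-mathlib-F0P2-p08 (g0) (L1; LEAD F0P6-plan (g14) BATCH #50 (4) «I2 → F0P2-p08»;
spec K2Liu-p02 (g7) CENSUS (u-0c) §1 row `hMID` ∕ §2 I2 «Iwasawa rewriting `hMIDF` (left-`N_Δ(𝔸)`-invariance of `F`: covering-weight integral right-invariance)»):
Track B «K2-LIT», hLiu418 = stmt-HodgeConjecture-24832, road `K2_Liu`, socket #41, ROAD Φ, organ G5 (u-0c) file I2 part 2: THE IWASAWA–LEVI REWRITING OF THE MIDDLE CELL.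
-/
import Summits.HodgeConjecture.HodgeConjecture.Theorems.K2LiuSiegelRationalLeviDecomposition   -- ★ α2c `Λ`: `deltaBlock_levi_apply`, `isSiegelDelta_levi_apply`, `conj_levi_mem_unipDelta`, `mem_unipDelta_of_deltaBlock_eq_one`
import Literature.MeasureTheory.Group.CoveringWeightsBochner                                     -- ★ `integral_wt_smul_eq_of_coveringSum_eq_one` (independence of the weight)
import HarnessLib

/-!
# Crux `HLiu418`, ROAD Φ, organ G5 (u-0c) file I2 part 2: `Λ(g)·h ∈ N_Δ(𝔸)·Λ(g·m(h))·k(h)` and the left-`N_Δ(𝔸)`-invariance of the weighted orbit integral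

Cell `hodgecm-mathlib`, crux item hLiu418 = `stmt-HodgeConjecture-24832`; squad K2 ∕ K2Liu (L1, LEAD F0P6-plan (g14)); prover F0P2-p08 (g0).  THEOREMS ONLY (no `def`,
no instance, no notation, no named-fact hypothesis, no `sorry`); lane `--supports stmt-HodgeConjecture-24832 --as helper`.  Companion of I2 part 1
`K2LiuSiegelIwasawaLeviCoordinate.exists_iwasawaLeviCoordinate` (`mx kx C₀ A₀ hmx`); the `hconj` letter of ★ α3-2 is ★ `K2LiuUnipDeltaConjMeasurePreserving.measurePreserving_conj_levi`.

THE LETTERS (`hMIDF` of K2Liu-p02 (g7)'s census: from `MID s h = c₀ Σ'_p F(Λ(γ_p)·h)` (★ α3-2 `middle_cell_eq_tsum`) to `… = c₀ Σ'_p F(Λ(γ_p·m(h))·k(h))`).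
* §1 (algebra of the Siegel Levi `Λ : GL_n(𝔸_L) →* H(𝔸)`, by value with its frame `hΛ` exactly as in ★ α2c ∕ α3-2): `mul_levi_inv_mem_unipDelta` — a Siegel element `p` with
  `Δ`-block `g` satisfies `p·Λ(g)⁻¹ ∈ N_Δ(𝔸)` (ADELIC Levi decomposition `P_Δ(𝔸) = N_Δ(𝔸)·Λ(GL_n(𝔸_L))`); `exists_unip_levi_mul_eq` — for `h = p·k`, `p ∈ P_Δ(𝔸)` with `Δ`-block
  `m`: `Λ(g)·h = u·(Λ(g·m)·k)` with `u ∈ N_Δ(𝔸)` (`Λ` normalises `N_Δ`); **`apply_levi_mul_eq_of_unipDelta_invariant`** — hence `F(Λ(g)·h) = F(Λ(g·m)·k)` for every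
  left-`N_Δ(𝔸)`-invariant `F`.
* §2 (analysis on the abelian group `N_Δ(𝔸)`, ★ `mul_comm_of_mem_unipDelta`): **`integral_wt_smul_apply_unip_mul_eq`** — for a left-invariant measure `νN` on `N_Δ(𝔸)`, a countable
  `Γ₀ ≤ N_Δ(𝔸)`, a `Γ₀`-covering weight `β₁`, `f` continuous with `y ↦ f(a·y)` left-`Γ₀`-invariant and `∫⁻ ‖f(a·u·x)‖ β₁(u) dνN < ∞`:
  `∫ β₁(u) • f(a·u·u'·x) dνN(u) = ∫ β₁(u) • f(a·u·x) dνN(u)` for every `u' ∈ N_Δ(𝔸)` (right translation by `u'` = left translation, then independence of the covering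
  weight ★ `integral_wt_smul_eq_of_coveringSum_eq_one` for `β₁` and `β₁(·u'⁻¹)`); **`unipDelta_invariant_of_eq_integral_wt_smul`** — so the `F` of ★ α3-2 (`hF`) is left-`N_Δ(𝔸)`-invariant.
[MoeglinWaldspurger1995, I.2.1, II.1.7]; [CogdellAnalyticTheory2004, §2.3]; [BorelJacquet1979, §4.1].
HONEST LABEL.  Count-neutral helper: `HC_CM` is proved only modulo the 7 printed citations (2 remaining named inputs: hLiu418 = `stmt-HodgeConjecture-24832`,
h413 = `stmt-HodgeConjecture-24833`) until rung 0 closes; this file closes no socket.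
-/

set_option autoImplicit false
set_option linter.dupNamespace false -- the mandated namespace repeats `HodgeConjecture.HodgeConjecture`

noncomputable section

open scoped Matrix ENNReal
open MeasureTheory NumberField IsDedekindDomain
open Literature.NumberTheory.Automorphic Literature.NumberTheory.Automorphic.UnitaryGroup Literature.NumberTheory.GaloisRepresentations
open Literature.NumberTheory.GelbartRogawski1991 Literature.NumberTheory.GelbartRogawski1991.GRConstruction
open Literature.NumberTheory.GelbartRogawski1991.AdaptedBlocks
open Literature.NumberTheory.K2Lit.SiegelDoubled
open Literature.MeasureTheory.Group
open Summit.HodgeConjecture.HodgeConjecture.Cruxes.HLiu418.K2LiuSiegelRationalLeviDecomposition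

namespace Summit.HodgeConjecture.HodgeConjecture.Cruxes.HLiu418.K2LiuSiegelIwasawaLeviRewriting

variable (L : Type) [Field L] [NumberField L] [IsCMField L]
variable {N M n : ℕ} (e : Fin N × Fin M ≃ Fin n)
  (dV : Fin N → L) (hdV : ∀ i, IsCMField.complexConj L (dV i) = dV i)
  (dW : Fin M → L) (hdW : ∀ i, IsCMField.complexConj L (dW i) = dW i)

/-! ## §1 The adelic Levi decomposition along `Λ` and the rewriting `Λ(g)·h = u·Λ(g·m(h))·k(h)` -/

section Levi

variable (Λ : GL (Fin n) (AdeleRing (𝓞 L) L) →* HA L e dV hdV dW hdW)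
  (hΛ : ∀ g : GL (Fin n) (AdeleRing (𝓞 L) L), blk L e dV hdV dW hdW (Λ g) =
    cayR (AdeleRing (𝓞 L) L) (Fin n) * Matrix.fromBlocks (g : Matrix (Fin n) (Fin n) (AdeleRing (𝓞 L) L)) 0 0
      (((gramR L e dV hdV dW hdW).map ((algebraMap L (AdeleRing (𝓞 L) L)).comp (algebraMap (Fp L) L)))⁻¹ *
        (((g⁻¹ : GL (Fin n) (AdeleRing (𝓞 L) L)) : Matrix (Fin n) (Fin n) (AdeleRing (𝓞 L) L)).map
          (conjAdele (Fp L) L (IsCMField.complexConj L)))ᵀ *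
        (gramR L e dV hdV dW hdW).map ((algebraMap L (AdeleRing (𝓞 L) L)).comp (algebraMap (Fp L) L))) *
      cayRinv (AdeleRing (𝓞 L) L) (Fin n))

include hΛ in
/-- **ADELIC LEVI DECOMPOSITION**: a Siegel element `p ∈ P_Δ(𝔸)` whose `Δ`-block is the unit `g ∈ GL_n(𝔸_L)` satisfies `p · Λ(g)⁻¹ ∈ N_Δ(𝔸)` (its `Δ`-block is
`g·g⁻¹ = 1`, ★ `mem_unipDelta_of_deltaBlock_eq_one`). [cite: MoeglinWaldspurger1995, I.2.1] [cite: HarrisKudlaSweet1996, §1 (1.12)] -/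
theorem mul_levi_inv_mem_unipDelta (hdV0 : ∀ i, dV i ≠ 0) (hdW0 : ∀ i, dW i ≠ 0) {p : HA L e dV hdV dW hdW} (hp : IsSiegelDelta L e dV hdV dW hdW p)
    {g : GL (Fin n) (AdeleRing (𝓞 L) L)} (hg : (g : Matrix (Fin n) (Fin n) (AdeleRing (𝓞 L) L)) = deltaBlock L e dV hdV dW hdW p) :
    p * (Λ g)⁻¹ ∈ unipDelta L e dV hdV dW hdW := by
  have hq : IsSiegelDelta L e dV hdV dW hdW (Λ g)⁻¹ := by
    rw [← map_inv]; exact isSiegelDelta_levi_apply L e dV hdV dW hdW Λ hΛ _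
  refine mem_unipDelta_of_deltaBlock_eq_one L e dV hdV dW hdW hdV0 hdW0 (isSiegelDelta_mul L e dV hdV dW hdW hp hq) ?_
  rw [deltaBlock_mul L e dV hdV dW hdW hp hq, ← map_inv, deltaBlock_levi_apply L e dV hdV dW hdW Λ hΛ, ← hg, ← Units.val_mul, mul_inv_cancel, Units.val_one]

include hΛ in
/-- hence `p = u · Λ(g)` with `u ∈ N_Δ(𝔸)`. [cite: MoeglinWaldspurger1995, I.2.1] -/
theorem exists_unip_mul_levi_of_siegel (hdV0 : ∀ i, dV i ≠ 0) (hdW0 : ∀ i, dW i ≠ 0) {p : HA L e dV hdV dW hdW} (hp : IsSiegelDelta L e dV hdV dW hdW p)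
    {g : GL (Fin n) (AdeleRing (𝓞 L) L)} (hg : (g : Matrix (Fin n) (Fin n) (AdeleRing (𝓞 L) L)) = deltaBlock L e dV hdV dW hdW p) :
    ∃ u : HA L e dV hdV dW hdW, u ∈ unipDelta L e dV hdV dW hdW ∧ p = u * Λ g :=
  ⟨p * (Λ g)⁻¹, mul_levi_inv_mem_unipDelta L e dV hdV dW hdW Λ hΛ hdV0 hdW0 hp hg, by rw [inv_mul_cancel_right]⟩

include hΛ in
/-- **`Λ(g)·h = u·(Λ(g·m)·k)` with `u ∈ N_Δ(𝔸)`** whenever `h·k⁻¹ ∈ P_Δ(𝔸)` has `Δ`-block `m` (`h = (h k⁻¹ Λ(m)⁻¹)·Λ(m)·k`, and `Λ(g)` normalises `N_Δ(𝔸)`,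
★ `conj_levi_mem_unipDelta`). [cite: MoeglinWaldspurger1995, I.2.1, II.1.7] [cite: BorelJacquet1979, §4.1] -/
theorem exists_unip_levi_mul_eq (hdV0 : ∀ i, dV i ≠ 0) (hdW0 : ∀ i, dW i ≠ 0) (h k : HA L e dV hdV dW hdW) (hp : IsSiegelDelta L e dV hdV dW hdW (h * k⁻¹))
    {m : GL (Fin n) (AdeleRing (𝓞 L) L)} (hm : (m : Matrix (Fin n) (Fin n) (AdeleRing (𝓞 L) L)) = deltaBlock L e dV hdV dW hdW (h * k⁻¹))
    (g : GL (Fin n) (AdeleRing (𝓞 L) L)) :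
    ∃ u : HA L e dV hdV dW hdW, u ∈ unipDelta L e dV hdV dW hdW ∧ Λ g * h = u * (Λ (g * m) * k) := by
  refine ⟨Λ g * (h * k⁻¹ * (Λ m)⁻¹) * (Λ g)⁻¹,
    conj_levi_mem_unipDelta L e dV hdV dW hdW Λ hΛ g (mul_levi_inv_mem_unipDelta L e dV hdV dW hdW Λ hΛ hdV0 hdW0 hp hm), ?_⟩
  rw [map_mul]
  group

include hΛ in
/-- **THE IWASAWA–LEVI REWRITING**: for a left-`N_Δ(𝔸)`-invariant `F : H(𝔸) → α`, `F(Λ(g)·h) = F(Λ(g·m)·k)` whenever `h·k⁻¹ ∈ P_Δ(𝔸)` has `Δ`-block `m` — the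
`hMIDF` step turning `Σ'_p F(Λ(γ_p)·h)` (★ α3-2) into `Σ'_p F(Λ(γ_p·m(h))·k(h))` at the Iwasawa Levi coordinate of I2 part 1.
[cite: MoeglinWaldspurger1995, II.1.7] [cite: BorelJacquet1979, §4.1] -/
theorem apply_levi_mul_eq_of_unipDelta_invariant (hdV0 : ∀ i, dV i ≠ 0) (hdW0 : ∀ i, dW i ≠ 0) {α : Type*} (F : HA L e dV hdV dW hdW → α)
    (hFN : ∀ u : HA L e dV hdV dW hdW, u ∈ unipDelta L e dV hdV dW hdW → ∀ x, F (u * x) = F x)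
    (h k : HA L e dV hdV dW hdW) (hp : IsSiegelDelta L e dV hdV dW hdW (h * k⁻¹))
    {m : GL (Fin n) (AdeleRing (𝓞 L) L)} (hm : (m : Matrix (Fin n) (Fin n) (AdeleRing (𝓞 L) L)) = deltaBlock L e dV hdV dW hdW (h * k⁻¹))
    (g : GL (Fin n) (AdeleRing (𝓞 L) L)) :
    F (Λ g * h) = F (Λ (g * m) * k) := by
  obtain ⟨u, hu, hgh⟩ := exists_unip_levi_mul_eq L e dV hdV dW hdW Λ hΛ hdV0 hdW0 h k hp hm g
  rw [hgh, hFN u hu]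

end Levi

/-! ## §2 The weighted orbit integral is left-`N_Δ(𝔸)`-invariant -/

section Integral

variable [MeasurableSpace (unipDelta L e dV hdV dW hdW)] [BorelSpace (unipDelta L e dV hdV dW hdW)]

/-- **RIGHT = LEFT TRANSLATION ON THE ABELIAN `N_Δ(𝔸)`**: `∫ φ(u·u') dνN(u) = ∫ φ dνN` for a left-invariant `νN` (★ `mul_comm_of_mem_unipDelta`).
[cite: MoeglinWaldspurger1995, I.2.1] -/
theorem integral_mul_right_eq_self_unipDelta (νN : Measure (unipDelta L e dV hdV dW hdW)) [νN.IsMulLeftInvariant]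
    {E : Type*} [NormedAddCommGroup E] [NormedSpace ℝ E] (φ : unipDelta L e dV hdV dW hdW → E) (u' : unipDelta L e dV hdV dW hdW) :
    ∫ u, φ (u * u') ∂νN = ∫ u, φ u ∂νN := by
  have hcomm : (fun u : unipDelta L e dV hdV dW hdW => φ (u * u')) = fun u => φ (u' * u) :=
    funext fun u => by rw [show u * u' = u' * u from Subtype.ext (mul_comm_of_mem_unipDelta L e dV hdV dW hdW u.2 u'.2)]
  rw [hcomm]
  exact integral_mul_left_eq_self φ u'

/-- **a right translate of a covering weight is a covering weight** (`Γ₀` acts on the left; `N_Δ(𝔸)` is a group). [folklore] -/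
theorem isCoveringWeight_mul_right {Γ₀ : Subgroup (unipDelta L e dV hdV dW hdW)} {β₁ : unipDelta L e dV hdV dW hdW → ℝ≥0∞}
    (hβ₁ : IsCoveringWeight Γ₀ β₁) (c : unipDelta L e dV hdV dW hdW) :
    IsCoveringWeight Γ₀ (fun v : unipDelta L e dV hdV dW hdW => β₁ (v * c)) := by
  refine ⟨hβ₁.1.comp (measurable_mul_const c), fun v => ?_⟩
  rw [coveringSum_apply, ← hβ₁.2 (v * c), coveringSum_apply]
  refine tsum_congr fun γ => ?_
  rw [Subgroup.smul_def, Subgroup.smul_def, smul_eq_mul, smul_eq_mul, mul_assoc]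

/-- **LEFT-`N_Δ(𝔸)`-INVARIANCE OF THE WEIGHTED ORBIT INTEGRAL.**  `νN` left-invariant on the abelian `N_Δ(𝔸)`, `Γ₀ ≤ N_Δ(𝔸)` countable, `β₁` a `Γ₀`-covering
weight, `f` continuous with `y ↦ f(a·y)` left-`Γ₀`-invariant and `∫⁻ ‖f(a·u·x)‖ β₁(u) dνN(u) < ∞`.  Then for every `u' ∈ N_Δ(𝔸)`
  `∫ β₁(u) • f(a·(u·(u'·x))) dνN(u) = ∫ β₁(u) • f(a·(u·x)) dνN(u)`:
substitute `u ↦ u·u'⁻¹… ` (`integral_mul_right_eq_self_unipDelta`), which moves `u'` into the weight `β₁(·u'⁻¹)` (again a `Γ₀`-covering weight), then the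
independence of the weight ★ `integral_wt_smul_eq_of_coveringSum_eq_one`. [cite: MoeglinWaldspurger1995, II.1.7] [cite: CogdellAnalyticTheory2004, §2.3] -/
theorem integral_wt_smul_apply_unip_mul_eq (νN : Measure (unipDelta L e dV hdV dW hdW)) [νN.IsMulLeftInvariant]
    {Γ₀ : Subgroup (unipDelta L e dV hdV dW hdW)} [Countable Γ₀] {β₁ : unipDelta L e dV hdV dW hdW → ℝ≥0∞} (hβ₁ : IsCoveringWeight Γ₀ β₁)
    {f : HA L e dV hdV dW hdW → ℂ} (hfc : Continuous f) (a x : HA L e dV hdV dW hdW)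
    (hinv : ∀ γ : unipDelta L e dV hdV dW hdW, γ ∈ Γ₀ → ∀ y : HA L e dV hdV dW hdW, f (a * ((γ : HA L e dV hdV dW hdW) * y)) = f (a * y))
    (hint : ∫⁻ u, ‖f (a * ((u : HA L e dV hdV dW hdW) * x))‖ₑ * β₁ u ∂νN ≠ ∞) (u' : unipDelta L e dV hdV dW hdW) :
    ∫ u, (β₁ u).toReal • f (a * ((u : HA L e dV hdV dW hdW) * (((u' : unipDelta L e dV hdV dW hdW) : HA L e dV hdV dW hdW) * x))) ∂νN =
      ∫ u, (β₁ u).toReal • f (a * ((u : HA L e dV hdV dW hdW) * x)) ∂νN := by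
  haveI : MeasurableConstSMul Γ₀ (unipDelta L e dV hdV dW hdW) := ⟨fun γ => measurable_const_mul (γ : unipDelta L e dV hdV dW hdW)⟩
  haveI : SMulInvariantMeasure Γ₀ (unipDelta L e dV hdV dW hdW) νN :=
    ⟨fun γ t _ht => by
      rw [show (fun v : unipDelta L e dV hdV dW hdW => γ • v) ⁻¹' t = (fun v => (γ : unipDelta L e dV hdV dW hdW) * v) ⁻¹' t from rfl, measure_preimage_mul]⟩
  -- move `u'` into the weight: `u ↦ u·u'` is `νN`-preserving on the abelian `N_Δ(𝔸)`
  have hsub : ∫ u, (β₁ u).toReal • f (a * ((u : HA L e dV hdV dW hdW) * (((u' : unipDelta L e dV hdV dW hdW) : HA L e dV hdV dW hdW) * x))) ∂νN =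
      ∫ v, (β₁ (v * u'⁻¹)).toReal • f (a * ((v : HA L e dV hdV dW hdW) * x)) ∂νN := by
    rw [← integral_mul_right_eq_self_unipDelta L e dV hdV dW hdW νN
      (fun v : unipDelta L e dV hdV dW hdW => (β₁ (v * u'⁻¹)).toReal • f (a * ((v : HA L e dV hdV dW hdW) * x))) u']
    refine integral_congr_ae (Filter.Eventually.of_forall fun u => ?_)
    simp only [mul_inv_cancel_right]
    simp only [Subgroup.coe_mul, mul_assoc]
  rw [hsub]
  -- independence of the covering weight for the left-`Γ₀`-invariant `v ↦ f(a·v·x)`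
  have hGm : StronglyMeasurable (fun v : unipDelta L e dV hdV dW hdW => f (a * ((v : HA L e dV hdV dW hdW) * x))) :=
    (hfc.comp (continuous_const.mul (continuous_subtype_val.mul continuous_const))).stronglyMeasurable
  have hGinv : ∀ (γ : Γ₀) (v : unipDelta L e dV hdV dW hdW),
      (fun v : unipDelta L e dV hdV dW hdW => f (a * ((v : HA L e dV hdV dW hdW) * x))) (γ • v) =
        (fun v : unipDelta L e dV hdV dW hdW => f (a * ((v : HA L e dV hdV dW hdW) * x))) v := fun γ v => by
    simp only [Subgroup.smul_def, smul_eq_mul, Subgroup.coe_mul, mul_assoc]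
    exact hinv _ γ.2 _
  have hβ₂ := isCoveringWeight_mul_right L e dV hdV dW hdW hβ₁ u'⁻¹
  exact (integral_wt_smul_eq_of_coveringSum_eq_one (Γ := Γ₀) νN hGm hGinv hβ₁.1 hβ₂.1 hβ₁.2 hβ₂.2 hint.lt_top).symm

/-- **THE `F` OF ★ α3-2 IS LEFT-`N_Δ(𝔸)`-INVARIANT**: if `F x = ∫ β₁(u) • f(a·(u·x)) dνN(u)` for all `x` (α3-2's `hF`, `a = ι(1, ĝ₀) = w₀`) under the hypotheses of
`integral_wt_smul_apply_unip_mul_eq` at every `x`, then `F(u'·x) = F x` for all `u' ∈ N_Δ(𝔸)` — the `hFN` input of `apply_levi_mul_eq_of_unipDelta_invariant`.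
[cite: MoeglinWaldspurger1995, II.1.7] [cite: CogdellAnalyticTheory2004, §2.3] -/
theorem unipDelta_invariant_of_eq_integral_wt_smul (νN : Measure (unipDelta L e dV hdV dW hdW)) [νN.IsMulLeftInvariant]
    {Γ₀ : Subgroup (unipDelta L e dV hdV dW hdW)} [Countable Γ₀] {β₁ : unipDelta L e dV hdV dW hdW → ℝ≥0∞} (hβ₁ : IsCoveringWeight Γ₀ β₁)
    {f : HA L e dV hdV dW hdW → ℂ} (hfc : Continuous f) (a : HA L e dV hdV dW hdW)
    (hinv : ∀ γ : unipDelta L e dV hdV dW hdW, γ ∈ Γ₀ → ∀ y : HA L e dV hdV dW hdW, f (a * ((γ : HA L e dV hdV dW hdW) * y)) = f (a * y))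
    (hint : ∀ x : HA L e dV hdV dW hdW, ∫⁻ u, ‖f (a * ((u : HA L e dV hdV dW hdW) * x))‖ₑ * β₁ u ∂νN ≠ ∞)
    (F : HA L e dV hdV dW hdW → ℂ) (hF : ∀ x, F x = ∫ u, (β₁ u).toReal • f (a * ((u : HA L e dV hdV dW hdW) * x)) ∂νN)
    (u' : HA L e dV hdV dW hdW) (hu' : u' ∈ unipDelta L e dV hdV dW hdW) (x : HA L e dV hdV dW hdW) :
    F (u' * x) = F x := by
  rw [hF, hF]
  exact integral_wt_smul_apply_unip_mul_eq L e dV hdV dW hdW νN hβ₁ hfc a x hinv (hint x) ⟨u', hu'⟩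

end Integral

end Summit.HodgeConjecture.HodgeConjecture.Cruxes.HLiu418.K2LiuSiegelIwasawaLeviRewriting

end
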